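import Mathlib
import Summits.Ventures.HodgeRepro.Tier4.Line1.RTFSetting
import Summits.Ventures.HodgeRepro.Tier4.Line1.ConvTest
import Summits.Ventures.HodgeRepro.Tier4.Line1.JContinuity

/-!
# Tier4/Line1/ConvApprox — `J(f₁ ⋆ f₂) ≠ 0` survives a small uniform perturbation of the FIRST factor: the
archimedean half of the F2′ → (S1b) bridge reduces to approximating `f₁` alone (supports in a fixed compact)

Blind re-derivation cell `pub-hodge-repro`, Tier 4 (README §9–§10), seat t4-L1-p4 (gen 4); the second analytic piece
of the archimedean half of the bridge (CENSUS v14 §D, S13899), generic over every `RTF.Setting G`.  Target tree path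
`lean/Summits/Ventures/HodgeRepro/Tier4/Line1/ConvApprox.lean`.  Mathlib + p2's `ConvTest` (`conv_isTest`,
`support_conv_subset`) and this seat's `JContinuity` (`exists_nhds_J_ne_zero`); no printed input.

WHAT IS PROVED.  `norm_conv_le`: `‖(f ⋆ f₂)(g)‖ ≤ ‖f‖_∞ · ∫ ‖f₂(h⁻¹)‖ dh` (the integrand is bounded by `η · ‖f₂(h⁻¹ g)‖`
and the substitution `h ↦ g h` — LEFT invariance of the Haar measure only — turns `∫ ‖f₂(h⁻¹ g)‖ dh` into the
constant `∫ ‖f₂(h⁻¹)‖ dh`); `conv_sub_left`: `(h − f₁) ⋆ f₂ = h ⋆ f₂ − f₁ ⋆ f₂` for test functions.  Hence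
**`exists_nhds_J_conv_ne_zero`**: for test functions `f₁, f₂` with `J(f₁ ⋆ f₂) ≠ 0` and a compact `M ⊇ tsupport f₁`,
there is `η > 0` such that EVERY test function `h` supported in `M` with `‖h − f₁‖_∞ ≤ η` has `J(h ⋆ f₂) ≠ 0`
(`JContinuity.exists_nhds_J_ne_zero` on the compact `M · tsupport f₂`).  For LINE L1: the isolating pair `(f₁, f₂)` of J2
has `J(f₁ ⋆ f₂) = O_{o₀}(f₁ ⋆ f₂) ≠ 0` (`J_eq_orbital_of_isolated`); any test function of a prescribed SHAPE (level
`K(N)`, finite-rank left-`finLevel`-type) uniformly close to `f₁` with support in the compact `M` therefore gives a pair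
of that shape with `J ≠ 0` — the archimedean half of the bridge is the DENSITY statement for that shape and nothing else.
Nothing here says anything about the status of the Hodge conjecture for CM abelian varieties, which is NOT proved
(HC_CM is NOT proved by anyone in this repository).
-/

set_option autoImplicit false

noncomputable section

namespace Summit.Ventures.HodgeRepro.Tier4.Line1.RTF

open MeasureTheory Topology
open scoped Pointwise

variable {G : Type} [Group G] [TopologicalSpace G] [IsTopologicalGroup G] [MeasurableSpace G] [BorelSpace G]

namespace Setting

variable (S : Setting G)

/-- `∫ ‖f₂(h⁻¹ g)‖ dh = ∫ ‖f₂(h⁻¹)‖ dh` (substitution `h ↦ g h`, left invariance) -/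
theorem integral_norm_inv_mul (f₂ : G → ℂ) (g : G) :
    ∫ h, ‖f₂ (h⁻¹ * g)‖ ∂S.μ = ∫ h, ‖f₂ h⁻¹‖ ∂S.μ := by
  haveI : S.μ.IsMulLeftInvariant := S.haar.toIsMulLeftInvariant
  have h := integral_mul_left_eq_self (μ := S.μ) (fun h => ‖f₂ (h⁻¹ * g)‖) g
  rw [← h]
  congr 1
  funext h
  rw [mul_inv_rev, mul_assoc, inv_mul_cancel, mul_one]

omit [MeasurableSpace G] [BorelSpace G] in
/-- the shifted function `h ↦ f₂ (h⁻¹ * g)` has compact support (in `{g} · (tsupport f₂)⁻¹`) -/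
theorem hasCompactSupport_shift {f₂ : G → ℂ} (hf₂ : IsTest f₂) (g : G) :
    HasCompactSupport fun h : G => f₂ (h⁻¹ * g) := by
  refine HasCompactSupport.intro ((isCompact_singleton (x := g)).mul hf₂.compact.inv) fun h hh => ?_
  by_contra hne
  apply hh
  have : h = g * (h⁻¹ * g)⁻¹ := by group
  rw [this]
  exact Set.mul_mem_mul (Set.mem_singleton g) (Set.inv_mem_inv.2 (subset_tsupport _ hne))

/-- **the sup-norm bound for a convolution**: `‖(f ⋆ f₂)(g)‖ ≤ η · ∫ ‖f₂(h⁻¹)‖ dh` when `‖f‖_∞ ≤ η` -/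
theorem norm_conv_le {f f₂ : G → ℂ} (hf₂ : IsTest f₂) {η : ℝ} (hf : ∀ g, ‖f g‖ ≤ η) (g : G) :
    ‖S.conv f f₂ g‖ ≤ η * ∫ h, ‖f₂ h⁻¹‖ ∂S.μ := by
  haveI : IsFiniteMeasureOnCompacts S.μ := S.haar.toIsFiniteMeasureOnCompacts
  have hcont : Continuous fun h : G => ‖f₂ (h⁻¹ * g)‖ :=
    (hf₂.cont.comp (continuous_inv.mul continuous_const)).norm
  have hint : Integrable (fun h : G => η * ‖f₂ (h⁻¹ * g)‖) S.μ :=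
    (hcont.integrable_of_hasCompactSupport (hasCompactSupport_shift hf₂ g).norm).const_mul η
  unfold Setting.conv
  calc ‖∫ h, f h * f₂ (h⁻¹ * g) ∂S.μ‖
      ≤ ∫ h, ‖f h * f₂ (h⁻¹ * g)‖ ∂S.μ := norm_integral_le_integral_norm _
    _ ≤ ∫ h, η * ‖f₂ (h⁻¹ * g)‖ ∂S.μ := by
        refine integral_mono_of_nonneg (Filter.Eventually.of_forall fun h => norm_nonneg _) hint
          (Filter.Eventually.of_forall fun h => ?_)
        simp only [norm_mul]
        exact mul_le_mul_of_nonneg_right (hf h) (norm_nonneg _)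
    _ = η * ∫ h, ‖f₂ (h⁻¹ * g)‖ ∂S.μ := integral_const_mul η _
    _ = η * ∫ h, ‖f₂ h⁻¹‖ ∂S.μ := by rw [S.integral_norm_inv_mul f₂ g]



/-- the convolution is linear in its first argument: `(h − f₁) ⋆ f₂ = h ⋆ f₂ − f₁ ⋆ f₂` (test functions) -/
theorem conv_sub_left {h f₁ f₂ : G → ℂ} (hh : IsTest h) (h₁ : IsTest f₁) (h₂ : IsTest f₂) (g : G) :
    S.conv (fun x => h x - f₁ x) f₂ g = S.conv h f₂ g - S.conv f₁ f₂ g := by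
  haveI : IsFiniteMeasureOnCompacts S.μ := S.haar.toIsFiniteMeasureOnCompacts
  have hc₂ : Continuous fun x : G => f₂ (x⁻¹ * g) := h₂.cont.comp (continuous_inv.mul continuous_const)
  have hi1 : Integrable (fun x : G => h x * f₂ (x⁻¹ * g)) S.μ :=
    (hh.cont.mul hc₂).integrable_of_hasCompactSupport (hh.compact.mul_right)
  have hi2 : Integrable (fun x : G => f₁ x * f₂ (x⁻¹ * g)) S.μ :=
    (h₁.cont.mul hc₂).integrable_of_hasCompactSupport (h₁.compact.mul_right)
  unfold Setting.conv
  rw [← integral_sub hi1 hi2]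
  congr 1
  funext x
  ring

/-- **`J(f₁ ⋆ f₂) ≠ 0` is stable under small uniform perturbations of `f₁` with supports in a fixed compact `M`**:
there is `η > 0` such that every test function `h` supported in `M` with `‖h − f₁‖_∞ ≤ η` has `J(h ⋆ f₂) ≠ 0`. -/
theorem exists_nhds_J_conv_ne_zero [T2Space G] {χ : S.T → ℂ} {χ' : S.T' → ℂ}
    (hχ : S.IsCharacter χ) (hχ' : S.IsCharacter' χ') {f₁ f₂ : G → ℂ} (h₁ : IsTest f₁) (h₂ : IsTest f₂)
    {M : Set G} (hM : IsCompact M) (hfM : tsupport f₁ ⊆ M) (hJ : S.J χ χ' (S.conv f₁ f₂) ≠ 0) :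
    ∃ η : ℝ, 0 < η ∧ ∀ h : G → ℂ, IsTest h → tsupport h ⊆ M → (∀ g, ‖h g - f₁ g‖ ≤ η) →
      S.J χ χ' (S.conv h f₂) ≠ 0 := by
  have hM' : IsCompact (M * tsupport f₂) := hM.mul h₂.compact
  have hsub : ∀ {h : G → ℂ}, IsTest h → tsupport h ⊆ M → tsupport (S.conv h f₂) ⊆ M * tsupport f₂ := by
    intro h hh hhM
    exact (S.conv_isTest hh h₂).2.trans (Set.mul_subset_mul_right hhM)
  obtain ⟨η₀, hη₀, hstab⟩ := S.exists_nhds_J_ne_zero hχ hχ' hM' (S.conv_isTest h₁ h₂).1 (hsub h₁ hfM) hJ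
  have hC0 : 0 ≤ ∫ h, ‖f₂ h⁻¹‖ ∂S.μ := integral_nonneg fun _ => norm_nonneg _
  refine ⟨η₀ / ((∫ h, ‖f₂ h⁻¹‖ ∂S.μ) + 1), by positivity, fun h hh hhM hclose => ?_⟩
  refine hstab (S.conv h f₂) (S.conv_isTest hh h₂).1 (hsub hh hhM) fun g => ?_
  rw [← S.conv_sub_left hh h₁ h₂ g]
  refine (S.norm_conv_le h₂ hclose g).trans ?_
  rw [div_mul_eq_mul_div, div_le_iff₀ (by positivity)]
  nlinarith

end Setting

end Summit.Ventures.HodgeRepro.Tier4.Line1.RTF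

end
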